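/-
Copyright (c) 2026 the pub-hodgecm-mathlib formalisation cell (harness21).  Prover seat hodgecm-mathlib-LH4-p08 (g2), req620 Track A «(D-RAM) FOUR-FRAME» squad, unit U3_Laws (iii),
MS ROAD STAGE B (Stage B lead LH4-p10 (g2), MS ledger LH4-p11; dealer LH4-plan (g11)): B56-ASSEMBLY `stub_B56_G1` (skeleton `B10-StableCountTypeZero.SKELETON.v1` c61f53438acbd4dd :84),
shared BRIDGE «F-RATIONALITY DEPTH OF THE GLUE UNIT in element currency» (also serves LH4-p07 (g3)'s B7 socket `stub_B7_H`).  2026-09-04.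
-/
import Literature.NumberTheory.LocalFields.WildQuadraticDatumNormOneQuotient   -- ★ B0 p855667 (LH4-p09 (g2)): `exists_fixed_near_glueUnit_iff`, `exists_unit_eq_div_map`, `v_div_map_sub_div_map_eq_of_coords`; brings `exists_fixed_coords_of_map_ne`, `map_varpi_ne`, `v_varpi_pow`
import HarnessLib

/-!
# Crux `H413`, MS ROAD STAGE B, bridge for the glue summands of `stub_B56_G1` ∕ `stub_B7_H`: the RELATIVE `F`-RATIONALITY DEPTH of the glue unit `(β − 1)∕(α − 1)` is `n₃ − d + 1`

Cell `hodgecm-mathlib` (D-0151), FLOOR 0, crux item H413 = `stmt-HodgeConjecture-24833`; lane `--supports stmt-HodgeConjecture-24833 --as helper` (count-neutral).  THEOREMS ONLY (no `def`,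
no instance, no notation, no `sorry`, default heartbeats).
THE MATHEMATICS (LH4-p10 (g2) MEMO v2 §4 (GG)∕(L3); ★ B0 `exists_fixed_near_glueUnit_iff` is the same statement in FIXED COORDINATES `α = a∕σa`, `a = a₀ + a₁ϖ`).  For norm-one `α, β ≠ 1` of a
ramified quadratic datum (`σ` involution, `|σ·| = |·|`, fixed elements of even valuation, `|ϖ| = exp(−1)`, `|ϖ − σϖ| = |ϖ|^d`, `d ≥ 1`) which are `d`-DEEP (`|α − 1|, |β − 1| ≤ |ϖ|^d`, as for
element data with `d ≤ N₀`) and have `|α − β| = |ϖ|^{n₃}` (`n₃ ≥ d`): for every `j`,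
`(∃ f fixed, |(β−1)∕(α−1) − f| ≤ |(β−1)∕(α−1)|·|ϖ|^j) ⟺ j ≤ n₃ − d + 1`.
Proof: ★ `exists_unit_eq_div_map` writes `α = a∕σa`, `β = b∕σb` with units `a, b`; ★ `exists_fixed_coords_of_map_ne` gives fixed coordinates `a = a₀ + a₁ϖ`, `b = b₀ + b₁ϖ`, with `a₁, b₁ ≠ 0`
because `α, β ≠ 1`; ★ B0 turns the left side into `|(a₁b₀ − a₀b₁)ϖ| ≤ |ϖ|^j`, and ★ `v_div_map_sub_div_map_eq_of_coords` (`|α − β| = |a₁b₀ − a₀b₁|·|ϖ|^d`) turns that into `n₃ − d + 1 ≥ j`.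
* §1 `exists_fixed_coords_of_div_map_ne_one` — fixed coordinates with NONZERO `ϖ`-part for a unit `u` with `u∕σu ≠ 1`.
* §2 HEAD **`exists_fixed_near_glueUnit_iff_le`** — the bridge; corollary **`exists_fixed_v_add_glueUnit_le_iff`** — the ABSOLUTE form the glue assemblies use:
  `(∃ f fixed, |f + (β−1)∕(α−1)| ≤ |ϖ|^e) ⟺ e − (n₁ − n₂) ≤ n₃ − d + 1` when `|(β−1)∕(α−1)| = |ϖ|^{n₁−n₂}` (`n₂ ≤ n₁`, `n₁ − n₂ ≤ e`).
HONEST LABEL.  Count-neutral; nothing printed is asserted; the census laws stay PROVER TARGETS; `HC_CM` is proved only modulo the 7 printed citations (2 remaining named inputs: hLiu418 =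
`stmt-HodgeConjecture-24832`, h413 = `stmt-HodgeConjecture-24833`) until rung 0 closes.

## References
* [Serre1979] J.-P. Serre, *Local Fields*, GTM 67 (1979), Ch. V §3 (filtration of the units of a ramified quadratic extension; norm-one elements as `a∕σa`), Ch. I §6 Prop. 18.
* [Kottwitz1986BaseChangeUnits] R. Kottwitz, *Base change for unit elements of Hecke algebras*, Compositio Math. 60 (1986), §1 pp. 240–241.
-/

set_option autoImplicit false

noncomputable section

namespace Summit.HodgeConjecture.HodgeConjecture.Cruxes.H413.F0P3cDyRamGlueUnitRationalityDepth

open Literature.NumberTheory.LocalFields Literature.NumberTheory.LocalFields.WildQuadraticDatum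
open scoped Valued WithZero

variable {K : Type*} [Field K] [Valued K ℤᵐ⁰] {σ : K →+* K} {ϖ : K} {d : ℕ}

/-! ## §1 Fixed coordinates with nonzero `ϖ`-part -/

/-- A unit `u` with `u∕σu ≠ 1` has fixed coordinates `u = u₀ + u₁ϖ` with `u₁ ≠ 0` (if `u₁ = 0` then `u` is fixed and `u∕σu = 1`). [cite: Serre1979, Ch. V §3] -/
theorem exists_fixed_coords_of_div_map_ne_one (hσ : ∀ x, σ (σ x) = x) (hϖ : Valued.v ϖ = WithZero.exp (-1 : ℤ))
    (hd : Valued.v (ϖ - σ ϖ) = Valued.v ϖ ^ d) {u : K} (hu : Valued.v u = 1) (hne : u / σ u ≠ 1) :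
    ∃ u₀ u₁ : K, σ u₀ = u₀ ∧ σ u₁ = u₁ ∧ u₁ ≠ 0 ∧ u = u₀ + u₁ * ϖ := by
  obtain ⟨u₀, u₁, hu₀, hu₁, huc⟩ := exists_fixed_coords_of_map_ne hσ (map_varpi_ne hϖ hd) u
  refine ⟨u₀, u₁, hu₀, hu₁, ?_, huc⟩
  rintro rfl
  apply hne
  have hσu : σ u = u := by rw [huc, zero_mul, add_zero, hu₀]
  have hu0 : u ≠ 0 := (Valuation.ne_zero_iff _).1 (by rw [hu]; exact one_ne_zero)
  rw [hσu, div_self hu0]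

/-! ## §2 HEAD — the relative F-rationality depth of the glue unit -/

/-- **THE GLUE UNIT IS `F`-RATIONAL EXACTLY TO RELATIVE DEPTH `n₃ − d + 1`** (element currency of ★ B0 `exists_fixed_near_glueUnit_iff`): for `d`-deep norm-one `α, β ≠ 1` with
`|α − β| = |ϖ|^{n₃}`, `n₃ ≥ d ≥ 1`, and every `j`: `(∃ f, σ f = f ∧ |(β−1)∕(α−1) − f| ≤ |(β−1)∕(α−1)|·|ϖ|^j) ⟺ j ≤ n₃ − d + 1`.
[cite: Serre1979, Ch. V §3] [cite: Kottwitz1986BaseChangeUnits, §1 pp. 240–241] -/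
theorem exists_fixed_near_glueUnit_iff_le (hσ : ∀ x, σ (σ x) = x) (hvσ : ∀ a, Valued.v (σ a) = Valued.v a)
    (hfix : ∀ x : K, σ x = x → x ≠ 0 → ∃ n : ℤ, Valued.v x = WithZero.exp (2 * n)) (hϖ : Valued.v ϖ = WithZero.exp (-1 : ℤ))
    (hd : Valued.v (ϖ - σ ϖ) = Valued.v ϖ ^ d) (hd1 : 1 ≤ d) {α β : K} (hα : α * σ α = 1) (hβ : β * σ β = 1) (hα1 : α ≠ 1) (hβ1 : β ≠ 1)
    (hαd : Valued.v (α - 1) ≤ Valued.v ϖ ^ d) (hβd : Valued.v (β - 1) ≤ Valued.v ϖ ^ d) {n₃ : ℕ} (h₃ : Valued.v (α - β) = Valued.v ϖ ^ n₃) (hdn : d ≤ n₃)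
    (j : ℕ) :
    (∃ f : K, σ f = f ∧ Valued.v ((β - 1) / (α - 1) - f) ≤ Valued.v ((β - 1) / (α - 1)) * Valued.v ϖ ^ j) ↔ j ≤ n₃ - d + 1 := by
  obtain ⟨a, ha, rfl⟩ := exists_unit_eq_div_map hσ hvσ hfix hϖ hd hd1 hα hαd
  obtain ⟨b, hb, rfl⟩ := exists_unit_eq_div_map hσ hvσ hfix hϖ hd hd1 hβ hβd
  obtain ⟨a₀, a₁, ha₀, ha₁, ha₁0, rfl⟩ := exists_fixed_coords_of_div_map_ne_one hσ hϖ hd ha hα1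
  obtain ⟨b₀, b₁, hb₀, hb₁, hb₁0, rfl⟩ := exists_fixed_coords_of_div_map_ne_one hσ hϖ hd hb hβ1
  rw [exists_fixed_near_glueUnit_iff hσ hvσ hfix hϖ hd ha₀ ha₁ hb₀ hb₁ ha₁0 hb₁0 ha hb j]
  -- `|a₁b₀ − a₀b₁|·|ϖ|^d = |ϖ|^{n₃}`
  have hc := v_div_map_sub_div_map_eq_of_coords hvσ hd ha₀ ha₁ hb₀ hb₁ ha hb
  rw [h₃] at hc
  have hvϖ0 : Valued.v ϖ ≠ 0 := by rw [hϖ]; exact WithZero.exp_ne_zero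
  have hcv : Valued.v (a₁ * b₀ - a₀ * b₁) = Valued.v ϖ ^ (n₃ - d) := by
    rw [← Nat.sub_add_cancel hdn, pow_add] at hc
    exact (mul_left_injective₀ (pow_ne_zero _ hvϖ0) hc).symm
  rw [map_mul, hcv, ← pow_succ, v_varpi_pow hϖ, v_varpi_pow hϖ, WithZero.exp_le_exp]
  omega

/-- **ABSOLUTE FORM** used by the glue assemblies: if moreover `|(β − 1)∕(α − 1)| = |ϖ|^{g}` (`g = n₁ − n₂` on a glue foot) and `g ≤ e`, then
`(∃ f, σ f = f ∧ |f + (β−1)∕(α−1)| ≤ |ϖ|^e) ⟺ e − g ≤ n₃ − d + 1`. [cite: Serre1979, Ch. V §3] [cite: Kottwitz1986BaseChangeUnits, §1 pp. 240–241] -/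
theorem exists_fixed_v_add_glueUnit_le_iff (hσ : ∀ x, σ (σ x) = x) (hvσ : ∀ a, Valued.v (σ a) = Valued.v a)
    (hfix : ∀ x : K, σ x = x → x ≠ 0 → ∃ n : ℤ, Valued.v x = WithZero.exp (2 * n)) (hϖ : Valued.v ϖ = WithZero.exp (-1 : ℤ))
    (hd : Valued.v (ϖ - σ ϖ) = Valued.v ϖ ^ d) (hd1 : 1 ≤ d) {α β : K} (hα : α * σ α = 1) (hβ : β * σ β = 1) (hα1 : α ≠ 1) (hβ1 : β ≠ 1)
    (hαd : Valued.v (α - 1) ≤ Valued.v ϖ ^ d) (hβd : Valued.v (β - 1) ≤ Valued.v ϖ ^ d) {n₃ : ℕ} (h₃ : Valued.v (α - β) = Valued.v ϖ ^ n₃) (hdn : d ≤ n₃)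
    {g e : ℕ} (hg : Valued.v ((β - 1) / (α - 1)) = Valued.v ϖ ^ g) (hge : g ≤ e) :
    (∃ f : K, σ f = f ∧ Valued.v (f + (β - 1) / (α - 1)) ≤ Valued.v ϖ ^ e) ↔ e - g ≤ n₃ - d + 1 := by
  rw [← exists_fixed_near_glueUnit_iff_le hσ hvσ hfix hϖ hd hd1 hα hβ hα1 hβ1 hαd hβd h₃ hdn (e - g), hg, ← pow_add, Nat.add_sub_cancel' hge]
  constructor
  · rintro ⟨f, hσf, hf⟩
    refine ⟨-f, by rw [map_neg, hσf], ?_⟩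
    rwa [sub_neg_eq_add, add_comm]
  · rintro ⟨f, hσf, hf⟩
    refine ⟨-f, by rw [map_neg, hσf], ?_⟩
    rw [neg_add_eq_sub]; exact hf

end Summit.HodgeConjecture.HodgeConjecture.Cruxes.H413.F0P3cDyRamGlueUnitRationalityDepth

end
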